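/-
Copyright (c) 2026 the pub-hodgecm-mathlib formalisation cell (harness21).  Prover seat hodgecm-mathlib-R90-C10-p06 (g3), R90-TF SLAB section S1 «Ch10-local» (base
R90-C10), h413 = `stmt-HodgeConjecture-24833`; line «B_pos» (U4Keys :182 in BRANCH B at positive depth, memo `R90/R90-C10-p05/g2/DESIGN-Bpos-inert.md` §5, S1 chair
R90-C10-plan (g2) DEALS 23:54:11Z (B-8)): brick (B-8) «THE SHARED C-PACK» — the three letters `(C, hCo, hθC)` and `hθmul` kept hypothesis-first by ★-pending (B-1′)
`R90S1BposBranchBTypeBasisTwoDepthCM.exists_normalised_typeBasis_twoDepth_of_normChar_eq_one`, DISCHARGED from the conductor letter `hcond` (and, for `hθmul`, ★ p862709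
`theta_mul_concave`).  2026-09-05.
-/
import Summits.HodgeConjecture.HodgeConjecture.Theorems.K2E3ConcaveLevelIwahoriCharacterCM   -- ★ p862709 (K2E3-p34 (g2)): `theta_mul_concave`; brings ★ Z2A-3b `K2E3DepthZeroIwahoriCharacterCM` (`coe_eA_apply`, `isUnit_of_apply_ne_zero`, the (G3) frame)
import Literature.NumberTheory.Automorphic.GLnCongruenceSubgroups                             -- ★ `congruenceGL` (principal congruence subgroups of `GL_n`), `mem_congruenceGL_iff`, `isOpen_congruenceGL`
import Literature.NumberTheory.Automorphic.ValuedFieldValuativeRelBridge                     -- ★ `v_le_iff_valuation_le` (`Valued.v` ↔ `ValuativeRel.valuation`)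
import HarnessLib

/-!
# R90-TF S1 «Ch10-local» ∕ K2 E3 «U4Keys» :182, BRANCH B AT POSITIVE DEPTH — brick (B-8): THE C-PACK `(C, hCo, hθC)` + `hθmul` OF THE TWO-DEPTH TYPE BASIS
# «`θ(g) = χ₁(g₀₀)` is TRIVIAL on the principal congruence subgroup `C = eA⁻¹(U_w ∩ K_{|ϖ|ⁿ})` of the conductor level `n` (open), and MULTIPLICATIVE on `J_e`»
# [Casselman1995 Prop. 1.4.4; Roche1998 §3; BruhatTits1972 (4.4.4), (6.4.9); MoyPrasad1996 §3]

Cell `pub/hodgecm-mathlib`, crux H413 = `stmt-HodgeConjecture-24833`, route of record `HCCMUnconditional` (no route verbs); R90-TF section S1 (junction socket A2′ = U4Keys :217,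
REL over :155 and :182).  THEOREMS ONLY (no `def`, no `instance`, no `notation`, no named-fact hypothesis, no `sorry`); lane `--supports stmt-HodgeConjecture-24833 --as helper`,
count-neutral.  NOT THE PAYER of :182.  FRAME = the (G3) frame of the d0B files `(L v) (w hw) (eA heA) (ϖ hϖ)` + (§2 only) the two-depth letters of ★ p862547 `(r₁ s₁ r₂ s₂) (Jg hJg)
(Je hJe)`.

THE POINT (memo §2 (E4)∕(E7), S1 chair DEALS 2026-09-04T23:54:11Z (B-8)).  The ★-pending two-depth type basis (B-1′)
`R90S1BposBranchBTypeBasisTwoDepthCM.exists_normalised_typeBasis_twoDepth_of_normChar_eq_one` keeps THREE letters hypothesis-first: `hθmul` (`θ` multiplicative on `J_e`) and the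
smoothness pair `(C, hCo, hθC)` (an OPEN subgroup on which `θ = 1`).  This file discharges them from the conductor letter `hcond` («`χ₁ u = 1` whenever `|u_{w′} − 1| ≤ |ϖ|ⁿ` at every
`w′ ∣ v`», ★ p861880's shape, `1 ≤ n`):
* §1 the C-PACK at the EXPLICIT principal congruence subgroup `C = eA⁻¹(U_w ∩ K_{|ϖ|ⁿ})` (★ `congruenceGL 3 (valuation ϖ ^ n)` pulled back along the subtype of `U_w` and `eA`; letter
  `hC : C = …` in the style of the frame letters `hK0 hK1 hJe`): **`isOpen_comap_congruenceGL`** (`hCo`, on the explicit term; ★ `isOpen_congruenceGL`) and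
  **`theta_eq_one_of_mem_congrLevel`** (`hθC`: for `c ∈ C`
  the entry `c₀₀` has `w`-component `(eA c)₀₀ ≡ 1 (mod 𝔭ⁿ)` (★ `mem_congruenceGL_iff`, ★ `v_le_iff_valuation_le`, ★ `coe_eA_apply`), hence is a unit of `L ⊗ L⁺_v` (non-split `v`, ★
  `isUnit_of_apply_ne_zero`) killed by `χ₁` (`hcond`)); packaged **`exists_isOpen_subgroup_theta_eq_one`** (`∃ C, IsOpen C ∧ ∀ c ∈ C, θ c = 1`).
* §2 **`theta_mul_twoDepth`** — the letter `hθmul` of (B-1′) VERBATIM (`∀ x ∈ Je, ∀ y ∈ Je, θ(xy) = θ(x)θ(y)`) at Roche's two-depth exponent matrix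
  `![![0, r₁, s₁], ![r₂, 0, r₁], ![s₂, r₂, 0]]`, read off ★ p862709 `theta_mul_concave` (letters `hcond`, `hcondF`, trace-one `t`, concavity `n ≤ r₁ + r₂`, `n ≤ 2r₁ + s₂`,
  `n ≤ s₁ + 2r₂`, `c ≤ s₁ + s₂`, `1 ≤ c ≤ n`).
HONEST LABEL.  HC_CM is proved only modulo the 7 printed citations (2 remaining named inputs: hLiu418 = `stmt-HodgeConjecture-24832`, h413 = `stmt-HodgeConjecture-24833`) until rung 0
closes; count-neutral — this file does NOT pay :182 or A2′; no printed citation is discharged.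

## References
* [Casselman1995] W. Casselman, *Introduction to the theory of admissible representations of `p`-adic reductive groups* (1995), §1.4, Prop. 1.4.4 (principal congruence subgroups
  are a basis of compact open neighbourhoods of `1`; a smooth character is trivial on one of them).
* [Roche1998] A. Roche, *Types and Hecke algebras for principal series representations of split reductive p-adic groups*, Ann. Sci. ÉNS (4) 31 (1998), §3 (the character `χ̃` of
  `J_χ`).
* [BruhatTits1972] F. Bruhat, J. Tits, *Groupes réductifs sur un corps local I*, Publ. Math. IHÉS 41 (1972), (4.4.4), (6.4.9).
* [MoyPrasad1996] A. Moy, G. Prasad, *Jacquet functors and unrefined minimal K-types*, Comment. Math. Helv. 71 (1996), §3.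
-/

set_option autoImplicit false
-- the mandated namespace has the single-problem summit's repeated segment (`HodgeConjecture.HodgeConjecture`)
set_option linter.dupNamespace false

noncomputable section

open NumberField IsDedekindDomain ValuativeRel
open scoped Matrix MatrixGroups WithZero Valued
open Literature.NumberTheory Literature.NumberTheory.Automorphic Literature.NumberTheory.Automorphic.UnitaryGroup
open Literature.NumberTheory.Rogawski1990

namespace Summit.HodgeConjecture.HodgeConjecture.R90.S1.BposCongruencePackTheta

open Summit.HodgeConjecture.HodgeConjecture.Cruxes.H413
open Summit.HodgeConjecture.HodgeConjecture.Cruxes.H413.K2E3DepthZeroIwahoriCharacterCM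

variable (L : Type) [Field L] [NumberField L] [IsCMField L] (v : HeightOneSpectrum (𝓞 ↥(maximalRealSubfield L)))
  (w : PlacesOver L v) (hw : IsCMField.complexConj L • w.1 = w.1)
  (eA : Gqs L v ≃ₜ* ↥(unitaryGroupOfForm (galAdicCompletionMap (L := L) (IsCMField.complexConj L) hw) ((StdForm.antidiagonal 3).over (w.1.adicCompletion L))))
  (heA : ∀ g : Gqs L v,
    ((eA g : ↥(unitaryGroupOfForm (galAdicCompletionMap (L := L) (IsCMField.complexConj L) hw) ((StdForm.antidiagonal 3).over (w.1.adicCompletion L)))) :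
        GL (Fin 3) (w.1.adicCompletion L)) =
      ((localNonsplitEquiv (IsCMField.complexConj L) (qsForm L) (IsCMField.complexConj_ne_one L) w hw g :
        ↥(unitaryGroupOfForm (galAdicCompletionMap (L := L) (IsCMField.complexConj L) hw) (placeForm (qsForm L) w.1))) : GL (Fin 3) (w.1.adicCompletion L)))
  {ϖ : w.1.adicCompletion L} (hϖ : Valued.v ϖ = WithZero.exp (-1 : ℤ))

/-! ## §1 The C-pack: `θ = 1` on the principal congruence subgroup `C = eA⁻¹(U_w ∩ K_{|ϖ|ⁿ})`, which is open -/

section CPack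

variable (n : ℕ)

include hϖ in
/-- **Letter `hCo`: `eA⁻¹(U_w ∩ K_{|ϖ|ⁿ})` is OPEN in `U(Φ₃)(L⁺_v)`** — the principal congruence subgroup `K_{|ϖ|ⁿ} ≤ GL₃(L_w)` is open (★ `isOpen_congruenceGL`, level `|ϖ|ⁿ ≠ 0`),
`U_w ↪ GL₃(L_w)` and `eA` are continuous (stated on the explicit subgroup term). [cite: Casselman1995, Prop. 1.4.4] [cite: BruhatTits1972, (6.4.9)] -/
theorem isOpen_comap_congruenceGL :
    IsOpen ((((congruenceGL 3 (valuation (w.1.adicCompletion L) ϖ ^ n)).comap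
      (unitaryGroupOfForm (galAdicCompletionMap (L := L) (IsCMField.complexConj L) hw) ((StdForm.antidiagonal 3).over (w.1.adicCompletion L))).subtype).comap
        eA.toMulEquiv.toMonoidHom : Subgroup (Gqs L v)) : Set (Gqs L v)) := by
  have hϖ0 : ϖ ≠ 0 := CartanUnique.uniformizer_ne_zero hϖ
  have hγ : valuation (w.1.adicCompletion L) ϖ ^ n ≠ 0 := pow_ne_zero n ((Valuation.ne_zero_iff _).2 hϖ0)
  have h := ((isOpen_congruenceGL (n := 3) hγ).preimage
    (continuous_subtype_val :
      Continuous fun u : ↥(unitaryGroupOfForm (galAdicCompletionMap (L := L) (IsCMField.complexConj L) hw) ((StdForm.antidiagonal 3).over (w.1.adicCompletion L))) =>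
        (u : GL (Fin 3) (w.1.adicCompletion L)))).preimage eA.continuous
  exact h

open Classical in
include hw heA hϖ in
/-- **Letter `hθC`: `θ(c) = 1` for `c ∈ C = eA⁻¹(U_w ∩ K_{|ϖ|ⁿ})`** (letter `hC : C = …` in the style of the frame letters `hK0 hK1 hJe`), `θ(g) := if h : IsUnit g₀₀ then χ₁(h.unit) else 0`, for
`χ₁ : (L ⊗ L⁺_v)ˣ → ℂˣ` of conductor `≤ n` (letter `hcond`: `χ₁ u = 1` whenever `|u_{w′} − 1| ≤ |ϖ|ⁿ` at every `w′ ∣ v`), `1 ≤ n`.  Proof: `(eA c) − 1` has entries of valuation `≤ |ϖ|ⁿ`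
(★ `mem_congruenceGL_iff`, ★ `v_le_iff_valuation_le`), in particular `|(eA c)₀₀ − 1| ≤ |ϖ|ⁿ < 1`, so the `w`-component `(eA c)₀₀` of `c₀₀` (★ `coe_eA_apply`) is a unit, `c₀₀` is a unit
of `L ⊗ L⁺_v` (non-split `v`: one place, ★ `isUnit_of_apply_ne_zero`), and `hcond` kills it. [cite: Casselman1995, Prop. 1.4.4] [cite: Roche1998, §3] [cite: MoyPrasad1996, §3] -/
theorem theta_eq_one_of_mem_congrLevel (C : Subgroup (Gqs L v))
    (hC : C = ((congruenceGL 3 (valuation (w.1.adicCompletion L) ϖ ^ n)).comap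
      (unitaryGroupOfForm (galAdicCompletionMap (L := L) (IsCMField.complexConj L) hw) ((StdForm.antidiagonal 3).over (w.1.adicCompletion L))).subtype).comap
        eA.toMulEquiv.toMonoidHom)
    (hn : 1 ≤ n) (χ₁ : (LocalRing L v)ˣ →* ℂˣ)
    (hcond : ∀ u : (LocalRing L v)ˣ, (∀ w' : PlacesOver L v, Valued.v (((u : LocalRing L v) w') - 1) ≤ Valued.v ϖ ^ n) → χ₁ u = 1)
    {c : Gqs L v} (hc : c ∈ C) :
    (if h : IsUnit (((c.val : GL (Fin 3) (LocalRing L v)) : Matrix (Fin 3) (Fin 3) (LocalRing L v)) 0 0) then ((χ₁ h.unit : ℂˣ) : ℂ) else 0) = 1 := by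
  subst hC
  have hcg : ((eA c : ↥(unitaryGroupOfForm (galAdicCompletionMap (L := L) (IsCMField.complexConj L) hw) ((StdForm.antidiagonal 3).over (w.1.adicCompletion L)))) :
      GL (Fin 3) (w.1.adicCompletion L)) ∈ congruenceGL 3 (valuation (w.1.adicCompletion L) ϖ ^ n) := hc
  -- `|(eA c)₀₀ − 1|_w ≤ |ϖ|ⁿ`
  have hb := (mem_congruenceGL_iff.1 hcg).2.1 0 0
  rw [Matrix.sub_apply, Matrix.one_apply_eq, ← map_pow, ← v_le_iff_valuation_le, map_pow] at hb
  have h00 := coe_eA_apply L v w hw eA heA c 0 0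
  -- hence `(eA c)₀₀` is a `w`-adic unit
  have hvϖ1 : Valued.v ϖ < 1 := by rw [hϖ, ← WithZero.exp_zero, WithZero.exp_lt_exp]; norm_num
  have hlt : Valued.v ϖ ^ n < 1 := pow_lt_one' hvϖ1 (Nat.one_le_iff_ne_zero.1 hn)
  have hv1 : Valued.v ((((eA c : ↥(unitaryGroupOfForm (galAdicCompletionMap (L := L) (IsCMField.complexConj L) hw) ((StdForm.antidiagonal 3).over (w.1.adicCompletion L)))) :
      GL (Fin 3) (w.1.adicCompletion L)) : Matrix (Fin 3) (Fin 3) (w.1.adicCompletion L)) 0 0) = 1 := by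
    have h := Valued.v.map_one_add_of_lt (hb.trans_lt hlt)
    rwa [add_sub_cancel] at h
  have hne : ((c.val : GL (Fin 3) (LocalRing L v)) : Matrix (Fin 3) (Fin 3) (LocalRing L v)) 0 0 w ≠ 0 := by
    rw [← h00]
    intro h
    rw [h, map_zero] at hv1
    exact zero_ne_one hv1
  have hunit : IsUnit (((c.val : GL (Fin 3) (LocalRing L v)) : Matrix (Fin 3) (Fin 3) (LocalRing L v)) 0 0) := isUnit_of_apply_ne_zero L v w hw _ hne
  -- `χ₁` kills the unit `c₀₀` (conductor `≤ n`, one place over `v`)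
  have hχ : χ₁ hunit.unit = 1 := by
    refine hcond _ fun w' => ?_
    obtain rfl := PlacesOver.eq_of_smul_eq (IsCMField.complexConj L) (IsCMField.complexConj_ne_one L) w hw w'
    rw [IsUnit.unit_spec, ← h00]
    exact hb
  rw [dif_pos hunit, hχ, Units.val_one]

open Classical in
include hw heA hϖ in
/-- **THE C-PACK, packaged: `∃ C ≤ U(Φ₃)(L⁺_v)` open with `θ = 1` on `C`** (`C := eA⁻¹(U_w ∩ K_{|ϖ|ⁿ})`, §1) — the smoothness letters `(C, hCo, hθC)` of the two-depth type basis
(B-1′) discharged from `hcond` alone. [cite: Casselman1995, Prop. 1.4.4] [cite: Roche1998, §3] -/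
theorem exists_isOpen_subgroup_theta_eq_one (hn : 1 ≤ n) (χ₁ : (LocalRing L v)ˣ →* ℂˣ)
    (hcond : ∀ u : (LocalRing L v)ˣ, (∀ w' : PlacesOver L v, Valued.v (((u : LocalRing L v) w') - 1) ≤ Valued.v ϖ ^ n) → χ₁ u = 1) :
    ∃ C : Subgroup (Gqs L v), IsOpen (C : Set (Gqs L v)) ∧
      ∀ c ∈ C, (if h : IsUnit (((c.val : GL (Fin 3) (LocalRing L v)) : Matrix (Fin 3) (Fin 3) (LocalRing L v)) 0 0) then ((χ₁ h.unit : ℂˣ) : ℂ) else 0) = 1 :=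
  ⟨_, isOpen_comap_congruenceGL L v w hw eA hϖ n, fun _ hc => theta_eq_one_of_mem_congrLevel L v w hw eA heA hϖ n _ rfl hn χ₁ hcond hc⟩

end CPack

/-! ## §2 The letter `hθmul` at Roche's two-depth exponent matrix -/

section ThetaMul

variable (r₁ s₁ r₂ s₂ : ℕ) (Jg : Subgroup ↥(unitaryGroupOfForm (galAdicCompletionMap (L := L) (IsCMField.complexConj L) hw) ((StdForm.antidiagonal 3).over (w.1.adicCompletion L))))
  (hJg : ∀ k : ↥(unitaryGroupOfForm (galAdicCompletionMap (L := L) (IsCMField.complexConj L) hw) ((StdForm.antidiagonal 3).over (w.1.adicCompletion L))),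
    k ∈ Jg ↔ ∀ i j, Valued.v (((k : GL (Fin 3) (w.1.adicCompletion L)) : Matrix (Fin 3) (Fin 3) (w.1.adicCompletion L)) i j) ≤
      Valued.v ϖ ^ (![![0, r₁, s₁], ![r₂, 0, r₁], ![s₂, r₂, 0]] : Fin 3 → Fin 3 → ℕ) i j)
  (Je : Subgroup (Gqs L v)) (hJe : Je = Jg.comap eA.toMulEquiv.toMonoidHom)

open Classical in
include heA hϖ hJg hJe in
/-- **Letter `hθmul`: `θ(xy) = θ(x)·θ(y)` for `x, y ∈ J_e`** at Roche's two-depth exponent matrix `e = (0, r₁, s₁; r₂, 0, r₁; s₂, r₂, 0)` with `1 ≤ r₂`, `1 ≤ s₂`, for `χ₁` with E-conductor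
`≤ n` (`hcond`) and F-conductor `≤ c` on the `(c ⊗ 1)`-fixed units (`hcondF`), `1 ≤ c ≤ n`, a trace-one `t ∈ 𝒪_w`, and the concavity inequalities `n ≤ r₁ + r₂`, `n ≤ 2r₁ + s₂`,
`n ≤ s₁ + 2r₂`, `c ≤ s₁ + s₂` — ★ p862709 `theta_mul_concave` read at this `e`, in the `∀ x ∈ Je, ∀ y ∈ Je` shape of (B-1′)'s letter. [cite: Roche1998, §3] [cite: MoyPrasad1996, §3]
[cite: BruhatTits1972, (6.4.9)] -/
theorem theta_mul_twoDepth (h10 : 1 ≤ r₂) (h20 : 1 ≤ s₂) (χ₁ : (LocalRing L v)ˣ →* ℂˣ) {n c : ℕ} (hc1 : 1 ≤ c) (hcn : c ≤ n)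
    (hcond : ∀ u : (LocalRing L v)ˣ, (∀ w' : PlacesOver L v, Valued.v (((u : LocalRing L v) w') - 1) ≤ Valued.v ϖ ^ n) → χ₁ u = 1)
    (hcondF : ∀ u : (LocalRing L v)ˣ, Units.map (conjLocal L (IsCMField.complexConj L) v : LocalRing L v →* LocalRing L v) u = u →
      (∀ w' : PlacesOver L v, Valued.v (((u : LocalRing L v) w') - 1) ≤ Valued.v ϖ ^ c) → χ₁ u = 1)
    {t : w.1.adicCompletion L} (ht : t + galAdicCompletionMap (L := L) (IsCMField.complexConj L) hw t = 1) (hvt : Valued.v t ≤ 1)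
    (h1 : n ≤ r₁ + r₂) (h2 : n ≤ 2 * r₁ + s₂) (h3 : n ≤ s₁ + 2 * r₂) (h4 : c ≤ s₁ + s₂) :
    ∀ x ∈ Je, ∀ y ∈ Je,
      (if h : IsUnit ((((x * y : Gqs L v).val : GL (Fin 3) (LocalRing L v)) : Matrix (Fin 3) (Fin 3) (LocalRing L v)) 0 0) then ((χ₁ h.unit : ℂˣ) : ℂ) else 0) =
        (if h : IsUnit (((x.val : GL (Fin 3) (LocalRing L v)) : Matrix (Fin 3) (Fin 3) (LocalRing L v)) 0 0) then ((χ₁ h.unit : ℂˣ) : ℂ) else 0) *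
          (if h : IsUnit (((y.val : GL (Fin 3) (LocalRing L v)) : Matrix (Fin 3) (Fin 3) (LocalRing L v)) 0 0) then ((χ₁ h.unit : ℂˣ) : ℂ) else 0) := by
  intro x hx y hy
  exact K2E3ConcaveLevelIwahoriCharacterCM.theta_mul_concave L v w hw eA heA hϖ _ Jg hJg Je hJe (by simpa using h10) (by simpa using h20) χ₁ hc1 hcn hcond hcondF ht hvt
    (by simpa using h1) (by simpa using h2) (by simpa using h3) (by simpa using h4) hx hy

end ThetaMul

end Summit.HodgeConjecture.HodgeConjecture.R90.S1.BposCongruencePackTheta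

end
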